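import Summits.AtomisticToContinuum.BoseEinsteinCondensation.Theorems.LatticeToPeriodicBridge.Negative.TwoBodyWitness

/-!
# Negative lemmas for crux `LatticeToPeriodicBridge` (stmt-AtomisticToContinuum-9674), III-b:
# the near-minimiser cell-pair Lorentzian statement of card `coarse-cell-lorentzian` fails at `v = 0`

Supports stmt-AtomisticToContinuum-9674 (route `BECStronglyRayleigh`, rank 4). The crux-ideate card
`Ideas/coarse-cell-lorentzian.md` (round 1) types as its First lemma `TwoBodyCellLorentzian`
(`Cruxes/LatticeToPeriodicBridge/IdeatorSketch1.lean`): for EVERY admissible `v` there should be a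
cell size `b₀` such that for all `b ≥ b₀`, all `M ≥ 2` and some `δ > 0`, every real non-negative
`δ`-near-minimiser of the periodic two-body energy on the torus of side `M b` has a cell-pair kernel
`K(x,y) = ∫_{C_x × C_y} Re Ψ` satisfying the reverse Cauchy–Schwarz (Lorentz-signature) inequality
`(ΣK)(uᵀKu) ≤ (𝟙ᵀKu)²` for all real `u`.

`not_twoBodyCellLorentzian`: this is FALSE as typed (statement restated verbatim, over tree
vocabulary, inside the theorem). Witness (part III-a, `Negative/TwoBodyWitness.lean`) at `v = 0`
(`isRepulsiveFiniteRange_zero`), `M = 2`, `b = b₀`: `Ψ_ε = k_ε(1 + ε|Θ_per|²)` with `ε` so small that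
its free energy `O(ε²)` is below the offered `δ`; its kernel is `K(x,y) = k_ε(b₀⁶ + ε[x = y = 0])`
(`kernel_witness`: flat part `vol(C_x × C_y) = b₀⁶`, `volume_cellPairSet`; bump part
`∫_{C_x×C_y}|Θ|² = [x = y = 0]` by support and `‖Θ‖₂ = 1`, `setIntegral_norm_sq_dilatedPair`), and a
flat kernel plus a positive bump on ONE diagonal cell pair violates reverse Cauchy–Schwarz at
`u = e_0 - e_z` (`bumpKernel_not_lorentzian`: `(ΣKu)² = Q² < (64P + Q)Q`) — Lorentz signature is not an
open condition at the rank-one (free) kernel.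

Classification (for the card, not a route item): MISSTATED — repaired by Fournais's standing hypothesis
`0 < scatteringLength v` (strict signature is open) or by the exact-minimiser form (`PairCellLorentzian`);
the witness misses both. Lesson (crux `Disproof.lean` §8a): positivity of the scattering length is
load-bearing on that line from `N = 2` on. No `def … : Prop`; no route statement asserted. `[folklore]`.
-/

noncomputable section

namespace Summit.AtomisticToContinuum.BoseEinsteinCondensation.Theorems.LatticeToPeriodicBridge.Negative

open Literature.MathematicalPhysics.QuantumManyBody.BoseGas
open _root_.MeasureTheory _root_.Filter _root_.Topology
open scoped ENNReal NNReal

/-! ## The finite-dimensional core: a "paired-in-one-cell" bump on a flat kernel is not Lorentzian -/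

/-- For a flat kernel `P > 0` plus a bump `Q > 0` concentrated on one diagonal cell pair `(a,a)`,
the reverse Cauchy–Schwarz (Lorentzian) inequality fails at `u = e_a - e_z`, `z ≠ a`:
`(ΣKu)² = Q² < (n²P + Q)·Q = (ΣK)(uᵀKu)`. [folklore] -/
theorem bumpKernel_not_lorentzian {ι : Type*} [Fintype ι] [DecidableEq ι] {a z : ι} (haz : a ≠ z)
    {P Q : ℝ} (hP : 0 < P) (hQ : 0 < Q) :
    let K : ι → ι → ℝ := fun x y => P + if x = a ∧ y = a then Q else 0
    let u : ι → ℝ := fun x => (if x = a then 1 else 0) - if x = z then 1 else 0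
    (∑ x, ∑ y, K x y * u y) ^ 2 < (∑ x, ∑ y, K x y) * (∑ x, ∑ y, u x * K x y * u y) := by
  intro K u
  have hza : z ≠ a := fun h => haz h.symm
  -- Σ_y u y = 0
  have hu : ∑ y, u y = 0 := by
    simp only [u, Finset.sum_sub_distrib, Finset.sum_ite_eq', Finset.mem_univ, if_true, sub_self]
  -- row sums against u
  have hrow : ∀ x, ∑ y, K x y * u y = if x = a then Q else 0 := by
    intro x
    have : ∀ y, K x y * u y = P * u y + (if x = a ∧ y = a then Q else 0) * u y := by
      intro y; simp only [K]; ring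
    simp_rw [this, Finset.sum_add_distrib, ← Finset.mul_sum, hu, mul_zero, zero_add]
    by_cases hx : x = a
    · simp only [hx, true_and, if_true]
      rw [Finset.sum_eq_single a]
      · simp [u, haz]
      · intro y _ hy; simp [hy]
      · intro h; exact absurd (Finset.mem_univ a) h
    · simp [hx]
  have hA : ∑ x, ∑ y, K x y * u y = Q := by
    simp_rw [hrow, Finset.sum_ite_eq', Finset.mem_univ, if_true]
  have hC : ∑ x, ∑ y, u x * K x y * u y = Q := by
    have : ∀ x, ∑ y, u x * K x y * u y = u x * ∑ y, K x y * u y := by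
      intro x; rw [Finset.mul_sum]; refine Finset.sum_congr rfl fun y _ => ?_; ring
    simp_rw [this, hrow]
    rw [Finset.sum_eq_single a]
    · simp [u, haz]
    · intro x _ hx; simp [hx]
    · intro h; exact absurd (Finset.mem_univ a) h
  have hB : ∑ x, ∑ y, K x y = (Fintype.card ι : ℝ) ^ 2 * P + Q := by
    have hrowK : ∀ x, ∑ y, K x y = (Fintype.card ι : ℝ) * P + if x = a then Q else 0 := by
      intro x
      simp only [K, Finset.sum_add_distrib, Finset.sum_const, Finset.card_univ, nsmul_eq_mul]
      congr 1
      by_cases hx : x = a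
      · simp only [hx, true_and, Finset.sum_ite_eq', Finset.mem_univ, if_true]
      · simp [hx]
    simp_rw [hrowK, Finset.sum_add_distrib, Finset.sum_const, Finset.card_univ, nsmul_eq_mul,
      Finset.sum_ite_eq', Finset.mem_univ, if_true]
    ring
  rw [hA, hB, hC]
  have hcard : (1 : ℝ) ≤ Fintype.card ι := by
    have : 0 < Fintype.card ι := Fintype.card_pos_iff.2 ⟨a⟩
    exact_mod_cast this
  have hc2 : (1 : ℝ) ≤ (Fintype.card ι : ℝ) ^ 2 := by nlinarith [hcard]
  have hPQ : 0 < P * Q := mul_pos hP hQ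
  nlinarith [mul_le_mul_of_nonneg_right hc2 hPQ.le, hPQ]

/-! ## The half-cell geometry at `M = 2` and the kernel of the witness -/

section Kernel

/-- The half-cell `∏_k [x_k b, (x_k+1) b)` of the torus cell of side `2b`. [folklore] -/
def halfCell (b : ℝ) (x : Fin 3 → Fin 2) : Set Space :=
  {ξ : Space | ∀ k, ξ k ∈ Set.Ico (((x k : ℕ) : ℝ) * b) ((((x k : ℕ) : ℝ) + 1) * b)}

/-- The cell pair `C_x × C_y ⊂ (ℝ³)²`. [folklore] -/
def cellPairSet (b : ℝ) (x y : Fin 3 → Fin 2) : Set (Config 2) :=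
  {X : Config 2 | X 0 ∈ halfCell b x ∧ X 1 ∈ halfCell b y}

/-- Half-cells are measurable. [folklore] -/
theorem measurableSet_halfCell (b : ℝ) (x : Fin 3 → Fin 2) : MeasurableSet (halfCell b x) := by
  have : halfCell b x = ⋂ k : Fin 3, (fun ξ : Space => ξ k) ⁻¹'
      Set.Ico (((x k : ℕ) : ℝ) * b) ((((x k : ℕ) : ℝ) + 1) * b) := by
    ext ξ; simp [halfCell]
  rw [this]
  exact MeasurableSet.iInter fun k => measurableSet_Ico.preimage (by fun_prop)

/-- `|C_x| = b³`. [folklore] -/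
theorem volume_halfCell (b : ℝ) (x : Fin 3 → Fin 2) :
    volume (halfCell b x) = ENNReal.ofReal b ^ 3 := by
  have h : halfCell b x = (@WithLp.ofLp 2 (Fin 3 → ℝ)) ⁻¹'
      (Set.univ.pi fun k => Set.Ico (((x k : ℕ) : ℝ) * b) ((((x k : ℕ) : ℝ) + 1) * b)) := by
    ext ξ; simp [halfCell]
  rw [h, (PiLp.volume_preserving_ofLp (Fin 3)).measure_preimage
    (MeasurableSet.univ_pi fun _ => measurableSet_Ico).nullMeasurableSet, volume_pi_pi]
  have hk : ∀ k : Fin 3, volume (Set.Ico (((x k : ℕ) : ℝ) * b) ((((x k : ℕ) : ℝ) + 1) * b)) =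
      ENNReal.ofReal b := by
    intro k; rw [Real.volume_Ico]; congr 1; ring
  simp only [hk, Finset.prod_const, Finset.card_univ, Fintype.card_fin]

/-- The cell pair as a product set over `Fin 2`. [folklore] -/
theorem cellPairSet_eq_pi (b : ℝ) (x y : Fin 3 → Fin 2) :
    cellPairSet b x y = Set.univ.pi fun i : Fin 2 => if i = 0 then halfCell b x else halfCell b y := by
  ext X
  simp only [cellPairSet, Set.mem_setOf_eq, Set.mem_pi, Set.mem_univ, true_implies, Fin.forall_fin_two,
    Fin.isValue, if_true, show (1 : Fin 2) ≠ 0 from by decide, if_false]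

/-- Cell pairs are measurable. [folklore] -/
theorem measurableSet_cellPairSet (b : ℝ) (x y : Fin 3 → Fin 2) : MeasurableSet (cellPairSet b x y) := by
  rw [cellPairSet_eq_pi]
  exact MeasurableSet.univ_pi fun i => by split_ifs <;> exact measurableSet_halfCell b _

/-- `|C_x × C_y| = b⁶`. [folklore] -/
theorem volume_cellPairSet (b : ℝ) (x y : Fin 3 → Fin 2) :
    volume (cellPairSet b x y) = (ENNReal.ofReal b ^ 3) ^ 2 := by
  rw [cellPairSet_eq_pi, volume_pi_pi]
  simp only [Fin.prod_univ_two, Fin.isValue, if_true, show (1 : Fin 2) ≠ 0 from by decide, if_false,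
    volume_halfCell b]
  ring

/-- Cell pairs have finite volume. [folklore] -/
theorem volume_cellPairSet_lt_top (b : ℝ) (x y : Fin 3 → Fin 2) :
    volume (cellPairSet b x y) < ⊤ := by
  rw [volume_cellPairSet b]
  exact ENNReal.pow_lt_top (ENNReal.pow_lt_top ENNReal.ofReal_lt_top)

/-- Half-cells lie in the torus cell of side `2b`. [folklore] -/
theorem halfCell_subset_cell {b : ℝ} (hb : 0 ≤ b) (x : Fin 3 → Fin 2) : halfCell b x ⊆ cell (((2 : ℕ) : ℝ) * b) := by
  intro ξ hξ k
  have h := hξ k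
  have hx : ((x k : ℕ) : ℝ) ≤ 1 := by
    have := (x k).isLt
    exact_mod_cast Nat.lt_succ_iff.mp this
  have hx0 : (0 : ℝ) ≤ ((x k : ℕ) : ℝ) := by positivity
  refine ⟨le_trans (by positivity) h.1, lt_of_lt_of_le h.2 ?_⟩
  push_cast
  nlinarith

/-- Cell pairs lie in the two-particle fundamental cell of side `2b`. [folklore] -/
theorem cellPairSet_subset_cellN {b : ℝ} (hb : 0 ≤ b) (x y : Fin 3 → Fin 2) :
    cellPairSet b x y ⊆ cellN 2 (((2 : ℕ) : ℝ) * b) := by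
  intro X hX i
  fin_cases i
  · exact halfCell_subset_cell hb x hX.1
  · exact halfCell_subset_cell hb y hX.2

/-- Where the dilated pair (side `2b`) is non-zero, both particles are in the first half-cell. [folklore] -/
theorem mem_cellPairSet_zero_of_ne_zero {b : ℝ} (hb : 0 < b) {X : Config 2}
    (h : (dilatedPair (L := ((2 : ℕ) : ℝ) * b) (by positivity)).ψ X ≠ 0) : X ∈ cellPairSet b 0 0 := by
  have hc : ∀ i k, 0 ≤ X i k ∧ X i k < b := by
    intro i k
    have := dilatedPair_support (L := ((2 : ℕ) : ℝ) * b) (by positivity) h i k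
    push_cast at this
    constructor <;> nlinarith [this.1, this.2]
  simp only [cellPairSet, halfCell, Set.mem_setOf_eq, Pi.zero_apply, Fin.val_zero, Nat.cast_zero,
    zero_mul, zero_add, one_mul, Set.mem_Ico]
  exact ⟨fun k => hc 0 k, fun k => hc 1 k⟩

/-- Distinct half-cells are disjoint. [folklore] -/
theorem eq_of_mem_halfCell {b : ℝ} (hb : 0 < b) {x x' : Fin 3 → Fin 2} {ξ : Space}
    (h : ξ ∈ halfCell b x) (h' : ξ ∈ halfCell b x') : x = x' := by
  funext k
  have h1 := h k
  have h2 := h' k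
  -- the integer parts `x k`, `x' k` of `ξ k / b` agree
  by_contra hne
  have : (x k : ℕ) ≠ (x' k : ℕ) := fun e => hne (Fin.ext e)
  rcases Nat.lt_or_gt_of_ne this with hlt | hlt
  · have : ((x k : ℕ) : ℝ) + 1 ≤ ((x' k : ℕ) : ℝ) := by exact_mod_cast hlt
    nlinarith [h1.2, h2.1]
  · have : ((x' k : ℕ) : ℝ) + 1 ≤ ((x k : ℕ) : ℝ) := by exact_mod_cast hlt
    nlinarith [h2.2, h1.1]

/-- Off the diagonal pair `(0,0)` the dilated pair vanishes on `C_x × C_y`. [folklore] -/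
theorem dilatedPair_eq_zero_of_mem {b : ℝ} (hb : 0 < b) {x y : Fin 3 → Fin 2} (hxy : ¬ (x = 0 ∧ y = 0))
    {X : Config 2} (hX : X ∈ cellPairSet b x y) :
    (dilatedPair (L := ((2 : ℕ) : ℝ) * b) (by positivity)).ψ X = 0 := by
  by_contra h
  have h0 := mem_cellPairSet_zero_of_ne_zero hb h
  exact hxy ⟨(eq_of_mem_halfCell hb hX.1 h0.1), (eq_of_mem_halfCell hb hX.2 h0.2)⟩

/-- `∫ |Θ|² = 1` as a Bochner integral. [folklore] -/
theorem integral_norm_sq_dilatedPair {L : ℝ} (hL : 0 < L) :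
    ∫ X, ‖(dilatedPair hL).ψ X‖ ^ 2 = 1 := by
  have hc : Continuous fun X => ‖(dilatedPair hL).ψ X‖ ^ 2 :=
    (dilatedPair hL).contDiff.continuous.norm.pow 2
  rw [integral_eq_lintegral_of_nonneg_ae (f := fun X => ‖(dilatedPair hL).ψ X‖ ^ 2)
    (Filter.Eventually.of_forall fun X => by positivity) hc.aestronglyMeasurable]
  have : ∀ X, ENNReal.ofReal (‖(dilatedPair hL).ψ X‖ ^ 2) = ((‖(dilatedPair hL).ψ X‖₊ : ℝ≥0∞)) ^ 2 :=
    fun X => (coe_nnnorm_sq_eq_ofReal _).symm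
  simp_rw [this, (dilatedPair hL).norm_eq, ENNReal.toReal_one]

/-- `|Θ|²` is integrable (continuous, compact support). [folklore] -/
theorem integrable_norm_sq_dilatedPair {L : ℝ} (hL : 0 < L) :
    Integrable fun X => ‖(dilatedPair hL).ψ X‖ ^ 2 := by
  refine Continuous.integrable_of_hasCompactSupport ((dilatedPair hL).contDiff.continuous.norm.pow 2) ?_
  exact (hasCompactSupport_dilatedPair hL).norm.comp_left (g := fun r : ℝ => r ^ 2) (by simp)

/-- The cell-pair integrals of `|Θ|²`: `1` on `(0,0)`, `0` elsewhere. [folklore] -/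
theorem setIntegral_norm_sq_dilatedPair {b : ℝ} (hb : 0 < b) (x y : Fin 3 → Fin 2) :
    ∫ X in cellPairSet b x y, ‖(dilatedPair (L := ((2 : ℕ) : ℝ) * b) (by positivity)).ψ X‖ ^ 2 =
      if x = 0 ∧ y = 0 then 1 else 0 := by
  split_ifs with hxy
  · obtain ⟨rfl, rfl⟩ := hxy
    rw [setIntegral_eq_integral_of_forall_compl_eq_zero, integral_norm_sq_dilatedPair]
    intro X hX
    have : (dilatedPair (L := ((2 : ℕ) : ℝ) * b) (by positivity)).ψ X = 0 := by
      by_contra h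
      exact hX (mem_cellPairSet_zero_of_ne_zero hb h)
    simp [this]
  · refine setIntegral_eq_zero_of_forall_eq_zero fun X hX => ?_
    simp [dilatedPair_eq_zero_of_mem hb hxy hX]

/-- **The kernel of the witness**: `K(x,y) = k_ε (b⁶ + ε [x = y = 0])`. [folklore] -/
theorem kernel_witness {b : ℝ} (hb : 0 < b) {ε : ℝ} (hε : 0 ≤ ε) (x y : Fin 3 → Fin 2) :
    ∫ X in cellPairSet b x y, ((witness (L := ((2 : ℕ) : ℝ) * b) (by positivity) hε).ψ X).re =
      witnessConst (L := ((2 : ℕ) : ℝ) * b) (by positivity) ε *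
        (b ^ 6 + ε * if x = 0 ∧ y = 0 then 1 else 0) := by
  have hL : 0 < ((2 : ℕ) : ℝ) * b := by positivity
  set k := witnessConst hL ε with hk
  set Θ := dilatedPair hL with hΘ
  have hvol := volume_cellPairSet b x y
  have hvolR : (volume (cellPairSet b x y)).toReal = b ^ 6 := by
    rw [hvol, ENNReal.toReal_pow, ENNReal.toReal_pow, ENNReal.toReal_ofReal hb.le]; ring
  -- on the cell pair the witness is `k (1 + ε |Θ|²)`
  have heq : Set.EqOn (fun X => ((witness hL hε).ψ X).re)
      (fun X => k + (k * ε) * ‖Θ.ψ X‖ ^ 2) (cellPairSet b x y) := by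
    intro X hX
    have hXc : X ∈ cellN 2 (((2 : ℕ) : ℝ) * b) := cellPairSet_subset_cellN hb.le x y hX
    simp only []
    rw [witness_ψ, Complex.mul_re, witnessFun_re, witnessFun_im, Complex.ofReal_re, Complex.ofReal_im,
      pairPer_ψ_of_mem hL hXc]
    ring
  rw [setIntegral_congr_fun (measurableSet_cellPairSet b x y) heq]
  have hint : IntegrableOn (fun X => (k * ε) * ‖Θ.ψ X‖ ^ 2) (cellPairSet b x y) :=
    ((integrable_norm_sq_dilatedPair hL).const_mul (k * ε)).integrableOn
  have hconst : IntegrableOn (fun _ : Config 2 => k) (cellPairSet b x y) :=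
    integrableOn_const (hs := (volume_cellPairSet_lt_top b x y).ne)
  rw [integral_add hconst hint, setIntegral_const, measureReal_def, hvolR, integral_const_mul,
    setIntegral_norm_sq_dilatedPair hb x y, smul_eq_mul]
  ring

end Kernel

/-! ## The refutation -/

/-- `v = 0` is an admissible (repulsive, finite-range) potential. [folklore] -/
theorem isRepulsiveFiniteRange_zero : IsRepulsiveFiniteRange (0 : ℝ → ℝ≥0∞) :=
  ⟨measurable_const, 0, fun _ _ => rfl⟩

/-- **The card's First lemma `TwoBodyCellLorentzian` (coarse-cell-lorentzian, IdeatorSketch1) is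
false as typed.** At `v = 0` the witness `Ψ_ε = k_ε (1 + ε |Θ_per|²)` — `Θ` the two-body block state
in the first half-cell, `ε > 0` small — is a real non-negative `δ`-near-minimiser of the free periodic
two-body energy on the torus of side `2b₀` whose cell-pair kernel `k_ε(b₀⁶ + ε[x = y = 0])` violates the
reverse Cauchy–Schwarz (Lorentzian) inequality at `u = e_0 - e_1` (`bumpKernel_not_lorentzian`).
Misstated-class refutation: repaired by `0 < scatteringLength v` (then signature is strict, hence open)
or by the exact-minimiser form (`PairCellLorentzian`); the witness misses both. [folklore] -/
theorem not_twoBodyCellLorentzian :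
    ¬ (∀ v : ℝ → ENNReal, IsRepulsiveFiniteRange v →
      ∃ b₀ : ℝ, 0 < b₀ ∧ ∀ b : ℝ, b₀ ≤ b → ∀ M : ℕ, 2 ≤ M →
        ∃ δ : ENNReal, 0 < δ ∧ ∀ Ψ : PeriodicTrialState 2 ((M : ℝ) * b),
          (∀ X, 0 ≤ (Ψ.ψ X).re ∧ (Ψ.ψ X).im = 0) →
          periodicEnergy v Ψ ≤ periodicGroundStateEnergy v 2 ((M : ℝ) * b) + δ →
          let K : (Fin 3 → Fin M) → (Fin 3 → Fin M) → ℝ :=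
            fun x y => ∫ X in {X : Config 2 | X 0 ∈ {ξ : Space | ∀ k, ξ k ∈ Set.Ico (((x k : ℕ) : ℝ) * b) ((((x k : ℕ) : ℝ) + 1) * b)} ∧
                                X 1 ∈ {ξ : Space | ∀ k, ξ k ∈ Set.Ico (((y k : ℕ) : ℝ) * b) ((((y k : ℕ) : ℝ) + 1) * b)}},
              (Ψ.ψ X).re
          ∀ u : (Fin 3 → Fin M) → ℝ,
            (∑ x, ∑ y, K x y) * (∑ x, ∑ y, u x * K x y * u y) ≤ (∑ x, ∑ y, K x y * u y) ^ 2) := by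
  intro h
  obtain ⟨b₀, hb₀, hb⟩ := h 0 isRepulsiveFiniteRange_zero
  obtain ⟨δ, hδ, hΨ⟩ := hb b₀ le_rfl 2 le_rfl
  have hL : 0 < ((2 : ℕ) : ℝ) * b₀ := by positivity
  obtain ⟨S, hS0, hS⟩ := exists_bound_dilatedPair hL
  -- the energy budget: `𝓔[Ψ_ε] ≤ ε² C`
  have hEtop : periodicEnergy 0 (pairPer hL) ≠ ⊤ := (periodicEnergy_pairPer_lt_top hL).ne
  set C : ℝ := ((((2 : ℕ) : ℝ) * b₀) ^ 6)⁻¹ * (2 * S) ^ 2 * (periodicEnergy 0 (pairPer hL)).toReal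
    with hC
  have hC0 : 0 ≤ C := by positivity
  -- choice of ε
  obtain ⟨ε, hε0, hε1, hεδ⟩ : ∃ ε : ℝ, 0 < ε ∧ ε ≤ 1 ∧ ENNReal.ofReal (ε ^ 2 * C) ≤ δ := by
    by_cases hδtop : δ = ⊤
    · exact ⟨1, one_pos, le_rfl, hδtop ▸ le_top⟩
    · have hδr : 0 < δ.toReal := ENNReal.toReal_pos hδ.ne' hδtop
      refine ⟨min 1 (δ.toReal / (C + 1)), lt_min one_pos (by positivity), min_le_left _ _, ?_⟩
      refine (ENNReal.ofReal_le_ofReal ?_).trans (ENNReal.ofReal_toReal hδtop).le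
      set ε := min 1 (δ.toReal / (C + 1)) with hεdef
      have hε0 : 0 ≤ ε := by positivity
      have hε1 : ε ≤ 1 := min_le_left _ _
      have hε2 : ε ≤ δ.toReal / (C + 1) := min_le_right _ _
      have hε3 : ε * (C + 1) ≤ δ.toReal := by rwa [le_div_iff₀ (by positivity)] at hε2
      calc ε ^ 2 * C ≤ ε * C := by nlinarith [mul_le_mul_of_nonneg_right hε1 (mul_nonneg hε0 hC0)]
        _ ≤ ε * (C + 1) := by nlinarith
        _ ≤ δ.toReal := hε3
  have hε : 0 ≤ ε := hε0.le
  -- the witness is a near-minimiser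
  have hener : periodicEnergy 0 (witness hL hε) ≤
      periodicGroundStateEnergy 0 2 (((2 : ℕ) : ℝ) * b₀) + δ := by
    refine le_add_left (le_trans (periodicEnergy_witness_le hL hε hS) (le_trans ?_ hεδ))
    have hk := witnessConst_sq_le hL hε
    calc ENNReal.ofReal (witnessConst hL ε ^ 2) * ENNReal.ofReal ((2 * ε * S) ^ 2) *
          periodicEnergy 0 (pairPer hL)
        = ENNReal.ofReal (witnessConst hL ε ^ 2 * (2 * ε * S) ^ 2 *
            (periodicEnergy 0 (pairPer hL)).toReal) := by
          rw [ENNReal.ofReal_mul (by positivity), ENNReal.ofReal_mul (by positivity),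
            ENNReal.ofReal_toReal hEtop]
      _ ≤ ENNReal.ofReal (ε ^ 2 * C) := by
          refine ENNReal.ofReal_le_ofReal ?_
          calc witnessConst hL ε ^ 2 * (2 * ε * S) ^ 2 * (periodicEnergy 0 (pairPer hL)).toReal
              = witnessConst hL ε ^ 2 * (ε ^ 2 * (2 * S) ^ 2 * (periodicEnergy 0 (pairPer hL)).toReal) := by
                ring
            _ ≤ ((((2 : ℕ) : ℝ) * b₀) ^ 6)⁻¹ *
                  (ε ^ 2 * (2 * S) ^ 2 * (periodicEnergy 0 (pairPer hL)).toReal) :=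
                mul_le_mul_of_nonneg_right hk (by positivity)
            _ = ε ^ 2 * C := by rw [hC]; ring
  -- the card's conclusion for the witness, at `u = e_0 - e_1`
  set z : Fin 3 → Fin 2 := fun _ => 1 with hz
  have h0z : (0 : Fin 3 → Fin 2) ≠ z := by
    intro h0; have := congr_fun h0 0; simp [hz] at this
  have hcard := hΨ (witness hL hε) (witness_real_nonneg hL hε) hener
    (fun x => (if x = 0 then 1 else 0) - if x = z then 1 else 0)
  -- rewrite the kernel
  have hK : ∀ x y : Fin 3 → Fin 2,
      (∫ X in cellPairSet b₀ x y, ((witness hL hε).ψ X).re) =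
        witnessConst hL ε * b₀ ^ 6 + if x = 0 ∧ y = 0 then witnessConst hL ε * ε else 0 := by
    intro x y
    rw [kernel_witness hb₀ hε x y]
    split_ifs <;> ring
  have hcard' : (∑ x, ∑ y, (∫ X in cellPairSet b₀ x y, ((witness hL hε).ψ X).re)) *
      (∑ x, ∑ y, ((if x = 0 then 1 else 0) - if x = z then (1 : ℝ) else 0) *
        (∫ X in cellPairSet b₀ x y, ((witness hL hε).ψ X).re) *
        ((if y = 0 then 1 else 0) - if y = z then (1 : ℝ) else 0)) ≤
      (∑ x, ∑ y, (∫ X in cellPairSet b₀ x y, ((witness hL hε).ψ X).re) *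
        ((if y = 0 then 1 else 0) - if y = z then (1 : ℝ) else 0)) ^ 2 := hcard
  simp only [hK] at hcard'
  have hlt := bumpKernel_not_lorentzian (ι := Fin 3 → Fin 2) h0z
    (P := witnessConst hL ε * b₀ ^ 6) (Q := witnessConst hL ε * ε)
    (mul_pos (witnessConst_pos hL hε) (by positivity)) (mul_pos (witnessConst_pos hL hε) hε0)
  simp only [] at hlt
  linarith

end Summit.AtomisticToContinuum.BoseEinsteinCondensation.Theorems.LatticeToPeriodicBridge.Negative

end
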